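import Mathlib

/-!
# W20 — crux-triage r1 seat 1, GEN 20 (stmt-BirchSwinnertonDyer-19577 `OrdMissingLowerBoundAtTwo`)

Small kernel checks behind §G20-3 of `TRIAGE-r1-1.md` (normal form `c = 2` of the witness clause
`SharpKuriharaWitnessAtTwo` of `Lines/lambda_kolyvagin_rigidity_two.lean` on the S₃-image locus).
Scratch only; nothing here is proposed to the tree.
-/

namespace TriageR1Seat1.Gen20

open Matrix

/-- The two transvections generating `GL₂(𝔽₂) ≅ S₃`. -/
def tA : Matrix (Fin 2) (Fin 2) (ZMod 2) := !![1, 1; 0, 1]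
def tB : Matrix (Fin 2) (Fin 2) (ZMod 2) := !![1, 0; 1, 1]

/-- Their commutator `[tA, tB] = tA tB tA⁻¹ tB⁻¹ = tA tB tA tB` (both are involutions). -/
def comm3 : Matrix (Fin 2) (Fin 2) (ZMod 2) := tA * tB * tA * tB

theorem tA_sq : tA * tA = 1 := by decide
theorem tB_sq : tB * tB = 1 := by decide

/-- The commutator is the 3-cycle `!![1,1;1,0]` … -/
theorem comm3_eq : comm3 = !![1, 1; 1, 0] := by decide

/-- … of order `3` … -/
theorem comm3_cube : comm3 * comm3 * comm3 = 1 := by decide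

/-- … and it fixes NO nonzero vector of `𝔽₂²`: so on the S₃-image locus (`ρ̄_{E,2}` onto) the
commutator subgroup `A₃` of the image — contained in the image of `G_{ℚ^{ab}}` — has no fixed
`2`-torsion point, i.e. `E(ℚ^{ab})[2] = 0`, hence every cuspidal torsion point of the optimal
curve (rational over `ℚ(ζ_N) ⊂ ℚ^{ab}`) has ODD order. -/
theorem comm3_no_fixed_vector : ∀ v : Fin 2 → ZMod 2, comm3.mulVec v = v → v = 0 := by decide

/-- `det (comm3 - 1) = 1 ≠ 0` (the same fact as a determinant). -/
theorem det_comm3_sub_one : (comm3 - 1).det = 1 := by decide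

/-- JUNK at `2`: Mathlib's total inverse on `ZMod 4` gives `2 · 2⁻¹ = gcd(2,4) = 2`, so `2⁻¹ ≠ 0`
although `2` is not a unit — an UNSCALED reduction `num · den⁻¹` of a half-integral plus symbol is a
junk NONZERO residue, which is why the witness clause carries the guard `‖(c·[r]⁺ : ℚ_[2])‖ ≤ 1`. -/
theorem inv_two_zmod4_junk : (2 : ZMod 4) * (2 : ZMod 4)⁻¹ = 2 ∧ (2 : ZMod 4)⁻¹ ≠ 0 := by
  have h : (2 : ZMod 4) * (2 : ZMod 4)⁻¹ = 2 := by
    rw [ZMod.mul_inv_eq_gcd]; decide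
  refine ⟨h, ?_⟩
  intro h0
  rw [h0, mul_zero] at h
  exact absurd h (by decide)

/-- `2` is not a unit of `ℤ/4` (so the value above is junk, not an inverse). -/
theorem two_not_unit_zmod4 : ∀ y : ZMod 4, 2 * y ≠ 1 := by decide

/-- The one non-obvious step of the reduction «general scaling `c = 2^{1+e}·u` ⟹ scaling `2`»:
if `2^e · x ≠ 0` in `ℤ/2^k` then `e < k` and `x` is already nonzero in `ℤ/2^(k-e)`
(so a sharp witness at level `k` with scaling `2^{1+e}u` yields one at level `k - e ≥ 1` with
scaling `2`, inside Kim's window `k - e ≤ ord₂ Tam + 2`). -/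
theorem cast_ne_zero_of_two_pow_mul_ne_zero {k e : ℕ} (x : ZMod (2 ^ k))
    (h : ((2 ^ e : ℕ) : ZMod (2 ^ k)) * x ≠ 0) :
    e < k ∧ (ZMod.castHom (pow_dvd_pow 2 (Nat.sub_le k e)) (ZMod (2 ^ (k - e)))) x ≠ 0 := by
  haveI : NeZero (2 ^ k) := ⟨pow_ne_zero _ two_ne_zero⟩
  haveI : NeZero (2 ^ (k - e)) := ⟨pow_ne_zero _ two_ne_zero⟩
  have hek : e < k := by
    by_contra hle
    have hle : k ≤ e := not_lt.mp hle
    apply h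
    have : ((2 ^ e : ℕ) : ZMod (2 ^ k)) = 0 :=
      (CharP.cast_eq_zero_iff (ZMod (2 ^ k)) (2 ^ k) (2 ^ e)).mpr (pow_dvd_pow 2 hle)
    rw [this, zero_mul]
  refine ⟨hek, ?_⟩
  intro hx
  apply h
  -- write `x` as the cast of its value
  have hxv : (x.val : ZMod (2 ^ k)) = x := ZMod.natCast_zmod_val x
  have hcast : (ZMod.castHom (pow_dvd_pow 2 (Nat.sub_le k e)) (ZMod (2 ^ (k - e)))) x
      = (x.val : ZMod (2 ^ (k - e))) := by
    rw [ZMod.castHom_apply, ZMod.cast_eq_val]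
  rw [hcast] at hx
  have hdvd : 2 ^ (k - e) ∣ x.val := (CharP.cast_eq_zero_iff (ZMod (2 ^ (k - e))) (2 ^ (k - e)) _).mp hx
  have hpow : 2 ^ k = 2 ^ e * 2 ^ (k - e) := by
    rw [← pow_add]; congr 1; omega
  have hdvd' : 2 ^ k ∣ 2 ^ e * x.val := (dvd_of_eq hpow).trans (Nat.mul_dvd_mul_left _ hdvd)
  rw [← hxv, ← Nat.cast_mul]
  exact (CharP.cast_eq_zero_iff (ZMod (2 ^ k)) (2 ^ k) _).mpr hdvd'

end TriageR1Seat1.Gen20
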